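import Mathlib
import Summits.QuantumFields.YangMills.Theorems.TransverseWardBLGaussianDomination
import Literature.MathematicalPhysics.QuantumLattice.DuhamelTwoPointProofs
import HarnessLib

/-!
# The infrared bound for generalised plane rotators (second variation of Gaussian domination)

Route-independent helper for item stmt-QuantumFields-23102 `Theses.TransverseWardBL.InfraredBound`
(LINE g9-C of the ideator seat ym-idea-4 on route `TransverseWardBL`; an abelian `U(1)` line onto the
leaf `Theorems.U1HelicityGapTorusD4` — nothing here bears on the Yang–Mills mass gap).

In the Ginibre-model setting of `TransverseWardBLGaussianDomination` (compact second-countable abelian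
group `Ω`, Haar probability `μ`, characters `χₐ`, couplings `Jₐ ≥ 0`), Gaussian domination
`Z(t h) ≤ Z(0)` (`integral_exp_shifted_le`) is differentiated twice at `t = 0` under the integral sign
(`hasDerivAt_integral_of_bound`, uniformly bounded integrands on a compact space) and the
second-derivative test at a global maximum (the tree's `Matrix.deriv2_nonpos_of_forall_le`) gives

* `integral_sq_sum_imChar_mul_weight_le` —
  `∫ (∑ₐ Jₐ hₐ Im χₐ)² e^{∑ J Re χ} dμ ≤ ∫ (∑ₐ Jₐ hₐ² Re χₐ) e^{∑ J Re χ} dμ`;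
* `ginibreExpect_sq_sum_imChar_le` — the Gibbs form `⟨(∑ₐ Jₐ hₐ Im χₐ)²⟩_J ≤ ⟨∑ₐ Jₐ hₐ² Re χₐ⟩_J`.

For Wilson `U(1)` lattice gauge theory (`Jₐ = β`, `χ_p` = plaquette holonomy) this is the `δ = 0`
infrared (Gaussian-domination) bound `β⟨(∑_p h_p sin θ_p)²⟩ ≤ ∑_p h_p² ⟨cos θ_p⟩ ≤ |h|²`
(Fröhlich–Simon–Spencer 1976; Guth 1980; Fröhlich–Spencer 1982), closed in the companion file
`TransverseWardBLInfraredBound`.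
-/

noncomputable section

open MeasureTheory Filter Finset
open scoped Topology BigOperators
open Literature.Probability.LatticeModels

namespace Summit.QuantumFields.YangMills.Theorems.TransverseWardBL

/-! ### Differentiation under the integral sign on a compact space -/

section Parametric

variable {Ω : Type*} [TopologicalSpace Ω] [CompactSpace Ω] [MeasurableSpace Ω] [BorelSpace Ω]

/-- Differentiation under the integral sign for continuous integrands with a uniformly bounded
`t`-derivative, on a compact space with a finite measure. [folklore] -/
theorem hasDerivAt_integral_of_bound (μ : Measure Ω) [IsFiniteMeasure μ] {F F' : ℝ → Ω → ℝ}
    (hF : ∀ t, Continuous (F t)) (hF' : ∀ t, Continuous (F' t)) {C : ℝ}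
    (hb : ∀ t θ, |F' t θ| ≤ C) (hder : ∀ t θ, HasDerivAt (fun s => F s θ) (F' t θ) t) (t₀ : ℝ) :
    HasDerivAt (fun t => ∫ θ, F t θ ∂μ) (∫ θ, F' t₀ θ ∂μ) t₀ :=
  (hasDerivAt_integral_of_dominated_loc_of_deriv_le (μ := μ) (F := F) (F' := F') (x₀ := t₀)
    (bound := fun _ => C) (s := Set.univ) Filter.univ_mem
    (Filter.Eventually.of_forall fun t => (hF t).aestronglyMeasurable)
    (integrable_of_continuous_compactSpace μ (hF t₀)) (hF' t₀).aestronglyMeasurable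
    (ae_of_all _ fun θ t _ => by rw [Real.norm_eq_abs]; exact hb t θ) (integrable_const C)
    (ae_of_all _ fun θ t _ => hder t θ)).2

end Parametric

/-! ### The infrared bound (second variation of Gaussian domination) -/

section Derivatives

variable {Ω : Type*} [CommGroup Ω] [TopologicalSpace Ω] {ι : Type*} [Fintype ι]

/-- `t`-derivative of the shifted Hamiltonian `E(t) = ∑ Jₐ (Re χₐ cos(t hₐ) − Im χₐ sin(t hₐ))`. [folklore] -/
theorem hasDerivAt_shiftedHamiltonian (χ : ι → Ω →ₜ* Circle) (J h : ι → ℝ) (θ : Ω) (t : ℝ) :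
    HasDerivAt (fun s : ℝ =>
        ∑ a, J a * (reChar (χ a) θ * Real.cos (s * h a) - imChar (χ a) θ * Real.sin (s * h a)))
      (∑ a, J a * (reChar (χ a) θ * (-Real.sin (t * h a) * h a) -
        imChar (χ a) θ * (Real.cos (t * h a) * h a))) t := by
  refine HasDerivAt.fun_sum fun a _ => ?_
  exact (((hasDerivAt_mul_const (h a)).cos.const_mul _).sub
    ((hasDerivAt_mul_const (h a)).sin.const_mul _)).const_mul _

/-- Second `t`-derivative of the shifted Hamiltonian. [folklore] -/
theorem hasDerivAt_shiftedHamiltonian_deriv (χ : ι → Ω →ₜ* Circle) (J h : ι → ℝ) (θ : Ω) (t : ℝ) :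
    HasDerivAt (fun s : ℝ =>
        ∑ a, J a * (reChar (χ a) θ * (-Real.sin (s * h a) * h a) -
          imChar (χ a) θ * (Real.cos (s * h a) * h a)))
      (∑ a, J a * (reChar (χ a) θ * (-(Real.cos (t * h a) * h a) * h a) -
        imChar (χ a) θ * (-Real.sin (t * h a) * h a * h a))) t := by
  refine HasDerivAt.fun_sum fun a _ => ?_
  exact ((((hasDerivAt_mul_const (h a)).sin.neg.mul_const (h a)).const_mul _).sub
    (((hasDerivAt_mul_const (h a)).cos.mul_const (h a)).const_mul _)).const_mul _

/-- Bound `|E'(t)| ≤ 2 ∑ Jₐ |hₐ|`. [folklore] -/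
theorem abs_shiftedHamiltonian_deriv_le (χ : ι → Ω →ₜ* Circle) {J : ι → ℝ} (hJ : ∀ a, 0 ≤ J a)
    (h : ι → ℝ) (θ : Ω) (t : ℝ) :
    |∑ a, J a * (reChar (χ a) θ * (-Real.sin (t * h a) * h a) -
        imChar (χ a) θ * (Real.cos (t * h a) * h a))| ≤ ∑ a, J a * (2 * |h a|) := by
  refine abs_sum_mul_le hJ fun a => ?_
  have h1 : reChar (χ a) θ * (-Real.sin (t * h a) * h a) - imChar (χ a) θ * (Real.cos (t * h a) * h a)
      = (reChar (χ a) θ * (-Real.sin (t * h a)) - imChar (χ a) θ * Real.cos (t * h a)) * h a := by ring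
  rw [h1, abs_mul]
  refine mul_le_mul_of_nonneg_right ?_ (abs_nonneg _)
  exact abs_mul_sub_mul_le_two (abs_reChar_le_one _ _) (abs_imChar_le_one _ _)
    (by rw [abs_neg]; exact Real.abs_sin_le_one _) (Real.abs_cos_le_one _)

/-- Bound `|E''(t)| ≤ 2 ∑ Jₐ hₐ²`. [folklore] -/
theorem abs_shiftedHamiltonian_deriv2_le (χ : ι → Ω →ₜ* Circle) {J : ι → ℝ} (hJ : ∀ a, 0 ≤ J a)
    (h : ι → ℝ) (θ : Ω) (t : ℝ) :
    |∑ a, J a * (reChar (χ a) θ * (-(Real.cos (t * h a) * h a) * h a) -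
        imChar (χ a) θ * (-Real.sin (t * h a) * h a * h a))| ≤ ∑ a, J a * (2 * (h a) ^ 2) := by
  refine abs_sum_mul_le hJ fun a => ?_
  have h1 : reChar (χ a) θ * (-(Real.cos (t * h a) * h a) * h a) -
      imChar (χ a) θ * (-Real.sin (t * h a) * h a * h a)
      = (reChar (χ a) θ * (-Real.cos (t * h a)) - imChar (χ a) θ * (-Real.sin (t * h a))) * (h a) ^ 2 := by
    ring
  rw [h1, abs_mul, abs_of_nonneg (sq_nonneg (h a))]
  refine mul_le_mul_of_nonneg_right ?_ (sq_nonneg _)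
  exact abs_mul_sub_mul_le_two (abs_reChar_le_one _ _) (abs_imChar_le_one _ _)
    (by rw [abs_neg]; exact Real.abs_cos_le_one _) (by rw [abs_neg]; exact Real.abs_sin_le_one _)

end Derivatives

section Infrared

variable {Ω : Type*} [CommGroup Ω] [TopologicalSpace Ω] [IsTopologicalGroup Ω] [CompactSpace Ω]
  [SecondCountableTopology Ω] [MeasurableSpace Ω] [BorelSpace Ω] {ι : Type*} [Fintype ι]

/-- **Infrared bound (Gaussian domination at second order) for generalised plane rotators.**
For couplings `Jₐ ≥ 0` and any real weights `hₐ`,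
`∫ (∑ₐ Jₐ hₐ Im χₐ)² e^{∑ J Re χ} dμ ≤ ∫ (∑ₐ Jₐ hₐ² Re χₐ) e^{∑ J Re χ} dμ`:
the second variation at `t = 0` of `t ↦ Z(t h) ≤ Z(0)` (`integral_exp_shifted_le`), obtained by
differentiating twice under the integral sign. [folklore] -/
theorem integral_sq_sum_imChar_mul_weight_le (μ : Measure Ω) [μ.IsHaarMeasure]
    [IsProbabilityMeasure μ] (χ : ι → Ω →ₜ* Circle) {J : ι → ℝ} (hJ : ∀ a, 0 ≤ J a) (h : ι → ℝ) :
    ∫ θ, (∑ a, J a * h a * imChar (χ a) θ) ^ 2 * ginibreWeight χ J θ ∂μ ≤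
      ∫ θ, (∑ a, J a * (h a) ^ 2 * reChar (χ a) θ) * ginibreWeight χ J θ ∂μ := by
  -- the three integrands
  set E : ℝ → Ω → ℝ := fun t θ =>
    ∑ a, J a * (reChar (χ a) θ * Real.cos (t * h a) - imChar (χ a) θ * Real.sin (t * h a)) with hE
  set E₁ : ℝ → Ω → ℝ := fun t θ =>
    ∑ a, J a * (reChar (χ a) θ * (-Real.sin (t * h a) * h a) -
      imChar (χ a) θ * (Real.cos (t * h a) * h a)) with hE₁
  set E₂ : ℝ → Ω → ℝ := fun t θ =>
    ∑ a, J a * (reChar (χ a) θ * (-(Real.cos (t * h a) * h a) * h a) -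
      imChar (χ a) θ * (-Real.sin (t * h a) * h a * h a)) with hE₂
  set SJ : ℝ := ∑ a, J a * 2 with hSJ
  set S₁ : ℝ := ∑ a, J a * (2 * |h a|) with hS₁
  set S₂ : ℝ := ∑ a, J a * (2 * (h a) ^ 2) with hS₂
  have hEb : ∀ t θ, |E t θ| ≤ SJ := fun t θ => abs_shiftedHamiltonian_le χ hJ (fun a => t * h a) θ
  have hE₁b : ∀ t θ, |E₁ t θ| ≤ S₁ := fun t θ => abs_shiftedHamiltonian_deriv_le χ hJ h θ t
  have hE₂b : ∀ t θ, |E₂ t θ| ≤ S₂ := fun t θ => abs_shiftedHamiltonian_deriv2_le χ hJ h θ t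
  have hEc : ∀ t, Continuous (E t) := fun t => continuous_shiftedHamiltonian χ J (fun a => t * h a)
  have hE₁c : ∀ t, Continuous (E₁ t) := fun t => by
    simp only [hE₁]
    exact continuous_finsetSum _ fun _ _ => continuous_const.mul
      (((continuous_reChar _).mul continuous_const).sub ((continuous_imChar _).mul continuous_const))
  have hE₂c : ∀ t, Continuous (E₂ t) := fun t => by
    simp only [hE₂]
    exact continuous_finsetSum _ fun _ _ => continuous_const.mul
      (((continuous_reChar _).mul continuous_const).sub ((continuous_imChar _).mul continuous_const))
  have hEd : ∀ t θ, HasDerivAt (fun s => E s θ) (E₁ t θ) t := fun t θ =>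
    hasDerivAt_shiftedHamiltonian χ J h θ t
  have hE₁d : ∀ t θ, HasDerivAt (fun s => E₁ s θ) (E₂ t θ) t := fun t θ =>
    hasDerivAt_shiftedHamiltonian_deriv χ J h θ t
  -- `φ(t) = ∫ exp E(t)`, `φ₁(t) = ∫ E₁ exp E`, `φ₂(0) = ∫ (E₂ + E₁²) exp E`
  have hexpb : ∀ t θ, Real.exp (E t θ) ≤ Real.exp SJ := fun t θ =>
    Real.exp_le_exp.2 ((le_abs_self _).trans (hEb t θ))
  have hW₁b : ∀ t θ, |E₁ t θ * Real.exp (E t θ)| ≤ S₁ * Real.exp SJ := fun t θ => by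
    rw [abs_mul, abs_of_pos (Real.exp_pos _)]
    exact mul_le_mul (hE₁b t θ) (hexpb t θ) (Real.exp_pos _).le
      ((abs_nonneg _).trans (hE₁b t θ))
  have hW₂b : ∀ t θ, |(E₂ t θ + E₁ t θ * E₁ t θ) * Real.exp (E t θ)| ≤
      (S₂ + S₁ * S₁) * Real.exp SJ := fun t θ => by
    rw [abs_mul, abs_of_pos (Real.exp_pos _)]
    have h1 : |E₂ t θ + E₁ t θ * E₁ t θ| ≤ S₂ + S₁ * S₁ := by
      refine (abs_add_le _ _).trans (add_le_add (hE₂b t θ) ?_)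
      rw [abs_mul]
      exact mul_le_mul (hE₁b t θ) (hE₁b t θ) (abs_nonneg _) ((abs_nonneg _).trans (hE₁b t θ))
    exact mul_le_mul h1 (hexpb t θ) (Real.exp_pos _).le ((abs_nonneg _).trans h1)
  have hφd : ∀ t₀, HasDerivAt (fun t => ∫ θ, Real.exp (E t θ) ∂μ)
      (∫ θ, E₁ t₀ θ * Real.exp (E t₀ θ) ∂μ) t₀ := by
    intro t₀
    have := hasDerivAt_integral_of_bound μ (F := fun t θ => Real.exp (E t θ))
      (F' := fun t θ => E₁ t θ * Real.exp (E t θ)) (fun t => Real.continuous_exp.comp (hEc t))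
      (fun t => (hE₁c t).mul (Real.continuous_exp.comp (hEc t))) hW₁b
      (fun t θ => by
        have h1 := (hEd t θ).exp
        simpa [mul_comm] using h1) t₀
    exact this
  have hφ₁d : HasDerivAt (fun t => ∫ θ, E₁ t θ * Real.exp (E t θ) ∂μ)
      (∫ θ, (E₂ 0 θ + E₁ 0 θ * E₁ 0 θ) * Real.exp (E 0 θ) ∂μ) 0 := by
    have := hasDerivAt_integral_of_bound μ (F := fun t θ => E₁ t θ * Real.exp (E t θ))
      (F' := fun t θ => (E₂ t θ + E₁ t θ * E₁ t θ) * Real.exp (E t θ))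
      (fun t => (hE₁c t).mul (Real.continuous_exp.comp (hEc t)))
      (fun t => ((hE₂c t).add ((hE₁c t).mul (hE₁c t))).mul (Real.continuous_exp.comp (hEc t)))
      hW₂b (fun t θ => by
        have h1 := (hE₁d t θ).mul (hEd t θ).exp
        refine h1.congr_deriv ?_
        ring) 0
    exact this
  -- the maximum at `t = 0` is Gaussian domination
  have hmax : ∀ t, ∫ θ, Real.exp (E t θ) ∂μ ≤ ∫ θ, Real.exp (E 0 θ) ∂μ := by
    intro t
    have h1 := integral_exp_shifted_le μ χ hJ (fun a => t * h a)
    have h2 : (fun θ => Real.exp (E 0 θ)) = ginibreWeight χ J := by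
      funext θ; simp [hE, ginibreWeight, ginibreHamiltonian]
    rw [h2]
    exact h1
  have hle := Matrix.deriv2_nonpos_of_forall_le hmax hφd hφ₁d
  -- evaluate at `t = 0`
  have hE0 : ∀ θ, Real.exp (E 0 θ) = ginibreWeight χ J θ := fun θ => by
    simp [hE, ginibreWeight, ginibreHamiltonian]
  have hE₁0 : ∀ θ, E₁ 0 θ = -∑ a, J a * h a * imChar (χ a) θ := fun θ => by
    simp only [hE₁, zero_mul, Real.sin_zero, Real.cos_zero, neg_zero, mul_zero, one_mul,
      zero_sub, mul_neg, Finset.sum_neg_distrib]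
    congr 1
    exact Finset.sum_congr rfl fun a _ => by ring
  have hE₂0 : ∀ θ, E₂ 0 θ = -∑ a, J a * (h a) ^ 2 * reChar (χ a) θ := fun θ => by
    simp only [hE₂, zero_mul, Real.sin_zero, Real.cos_zero, neg_zero, mul_zero, one_mul,
      sub_zero, ← Finset.sum_neg_distrib]
    exact Finset.sum_congr rfl fun a _ => by ring
  have hint1 : Integrable (fun θ => (∑ a, J a * h a * imChar (χ a) θ) ^ 2 * ginibreWeight χ J θ) μ :=
    integrable_of_continuous_compactSpace μ (((continuous_finsetSum _ fun _ _ =>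
      continuous_const.mul (continuous_imChar _)).pow 2).mul (continuous_ginibreWeight χ J))
  have hint2 : Integrable (fun θ => (∑ a, J a * (h a) ^ 2 * reChar (χ a) θ) * ginibreWeight χ J θ) μ :=
    integrable_of_continuous_compactSpace μ ((continuous_finsetSum _ fun _ _ =>
      continuous_const.mul (continuous_reChar _)).mul (continuous_ginibreWeight χ J))
  have hrw : ∫ θ, (E₂ 0 θ + E₁ 0 θ * E₁ 0 θ) * Real.exp (E 0 θ) ∂μ =
      ∫ θ, (∑ a, J a * h a * imChar (χ a) θ) ^ 2 * ginibreWeight χ J θ ∂μ -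
        ∫ θ, (∑ a, J a * (h a) ^ 2 * reChar (χ a) θ) * ginibreWeight χ J θ ∂μ := by
    rw [← integral_sub hint1 hint2]
    refine integral_congr_ae (ae_of_all _ fun θ => ?_)
    simp only [hE0, hE₁0, hE₂0]
    ring
  rw [hrw] at hle
  linarith

/-- **Infrared bound, Gibbs form**: `⟨(∑ₐ Jₐ hₐ Im χₐ)²⟩_J ≤ ⟨∑ₐ Jₐ hₐ² Re χₐ⟩_J`. [folklore] -/
theorem ginibreExpect_sq_sum_imChar_le (μ : Measure Ω) [μ.IsHaarMeasure] [IsProbabilityMeasure μ]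
    (χ : ι → Ω →ₜ* Circle) {J : ι → ℝ} (hJ : ∀ a, 0 ≤ J a) (h : ι → ℝ) :
    ginibreExpect μ χ J (fun θ => (∑ a, J a * h a * imChar (χ a) θ) ^ 2) ≤
      ginibreExpect μ χ J (fun θ => ∑ a, J a * (h a) ^ 2 * reChar (χ a) θ) := by
  unfold ginibreExpect
  have hZ : 0 < ∫ θ, ginibreWeight χ J θ ∂μ :=
    integral_exp_pos (integrable_of_continuous_compactSpace μ (continuous_ginibreWeight χ J))
  exact div_le_div_of_nonneg_right (integral_sq_sum_imChar_mul_weight_le μ χ hJ h) hZ.le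

end Infrared

end Summit.QuantumFields.YangMills.Theorems.TransverseWardBL

end
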